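import Literature.NumberTheory.Automorphic.UnitaryGroupTruncatedKernelIntegrableOfCusp
import Literature.NumberTheory.Automorphic.UnitaryGroupKernelOffBorelVanishing
import Literature.NumberTheory.Automorphic.UnitaryGroupArthurKernelClassExpansion
import Literature.MeasureTheory.Group.InvariantQuotientCompactFibre
import Literature.NumberTheory.Automorphic.LevelOrbitPushforward
import HarnessLib

/-!
# Elliptic centralisers in `U(3)` are cocompact — by reduction theory, without classifying tori
(Rogawski, *Automorphic Representations of Unitary Groups in Three Variables* (1990), §2.2–§2.3,
pp. 13–14; Arthur, Duke Math. J. 45 (1978), §8, Thm. 8.1: for a class `𝔬` meeting no proper rational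
parabolic, `J_𝔬(f) = Σ_{γ} vol(G_γ(F)\G_γ(𝔸)) ∫_{G_γ(𝔸)\G(𝔸)} f(x⁻¹γx) dx` — the volumes are finite
because `G_γ` is anisotropic; Gelfand–Graev–Piatetski-Shapiro (1969), Ch. 1 §2 for the lattice lemma)

Topic `NumberTheory/Automorphic`; namespace `Literature.NumberTheory.Automorphic.UnitaryGroup`. THEOREMS
ONLY over accepted tree modules: no definition, no named fact, no `sorry`, no instance, no notation.

Setting: `G = U(J₃)` (★ `quasiSplit F E c 3`, `c` the involution of `E/F`, `hc : c * c = 1`), its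
rational points `G(F) =` ★ `arithmeticSubgroup`, the rational Borel `B(F) =` ★ `arithmeticBorel`, the
Iwasawa height `H =` ★ `borelHeight`, and a rational element `γ ∈ G(F)` NONE OF WHOSE `G(F)`-CONJUGATES
LIES IN `B(F)` (Arthur's «`𝔬 ∩ P(F) = ∅` for every proper `P`», `𝒫 = {G, B}` in rank one: `γ` is
elliptic). Then the centraliser `Z_γ(𝔸_F) = C_{G(𝔸_F)}(γ)` is compact modulo `Z_γ(F) = G(F) ∩ Z_γ(𝔸_F)`:

* §1 `exists_forall_borelHeight_mul_le_of_forall_conj_not_mem_arithmeticBorel` — **bounded height on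
  the centraliser**: there is `c₀ ≥ 1` with `H(δ z) ≤ c₀` for all `z ∈ Z_γ(𝔸_F)`, `δ ∈ G(F)`
  (`(δz)⁻¹ (δγδ⁻¹) (δz) = z⁻¹ γ z = γ` lies in the compact `{γ}` and `δγδ⁻¹ ∉ B(F)`, so Godement's
  bound ★ `exists_borelHeight_le_of_conj_mem_of_not_mem_arithmeticBorel` applies);
  `exists_isCompact_forall_exists_mul_mem_centralizer` — hence, by ★ H8a
  `forall_inv_le_vecHeight_of_forall_borelHeight_le` and Mahler's criterion
  ★ `exists_isCompact_forall_exists_toAdelic_mul_mem`, `Z_γ(𝔸_F) ⊆ G(F) · Kc` for ONE compact `Kc`.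
* §2 `exists_isCompact_centralizer_subset_mul_of_forall_conj_not_mem_arithmeticBorel` — **set form**:
  a compact `K ⊆ Z_γ(𝔸_F)` with `Z_γ(𝔸_F) ⊆ K · (G(F) ∩ Z_γ(𝔸_F))` (for `z ∈ Z_γ(𝔸_F)` write
  `δ z⁻¹ = k ∈ Kc`; the conjugate `δγδ⁻¹ = kγk⁻¹` lies in the FINITE set `G(F) ∩ Kc γ Kc⁻¹`
  (★ `finite_setOf_mem_arithmeticSubgroup_of_isCompact`); with one `p_t ∈ G(F)` per value `t`,
  `m = p_t⁻¹ δ ∈ Z_γ(F)` and `z = (k⁻¹ p_t) · m` — the skeleton of ★ `exists_isCompact_centralizer_subset_mul`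
  with its cocompact-lattice input replaced by §1).
* §3 **`compactSpace_centralizer_quotient_of_forall_conj_not_mem_arithmeticBorel`** —
  `Z_γ(𝔸_F) ⧸ (A_G G(F) ∩ Z_γ(𝔸_F))` IS COMPACT, in the letters of ★
  `AdelicGroupData.compactSpace_centralizer_quotient` (`A_G = 1` for `U(J₃)`:
  ★ `quotientSubgroup_quasiSplit`), so that the tree's geometric-side machinery (★ (c1), ★ (O-H))
  applies verbatim to the elliptic classes of the QUASI-SPLIT form; and the class-map form
  `compactSpace_centralizer_quotient_of_forall_cl_ne` for a conjugation-invariant class map `cl` and a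
  class `𝔬 = i` that misses `B(F)` (the hypothesis shape of ★ `truncatedKernelClass_eq_kernelClass_of_forall_ne`).
* §4 (ED. 2) **`isMulRightInvariant_centralizer_of_forall_conj_not_mem_arithmeticBorel`** — ELLIPTIC
  CENTRALISERS ARE UNIMODULAR: every Haar measure of `Z_γ(𝔸_F)` is right invariant, since `Z_γ(F)` is a
  discrete cocompact subgroup (§3 and ★ `LevelOrbit.isMulRightInvariant_of_compactSpace_quotient`;
  Deitmar–Echterhoff (2014), Lemma 9.3.3 «the centralizer `G_γ` is unimodular», here off the compact
  quotient case of ★ `isMulRightInvariant_centralizer_of_center'_eq_bot`); class-map form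
  `isMulRightInvariant_centralizer_of_forall_cl_ne` — the two-sidedness of the Haar measures `νC s` on
  the elliptic centralisers that the orbital unfolding of `J^T_𝔬` binds.

## References

* J. D. Rogawski, *Automorphic Representations of Unitary Groups in Three Variables*, Annals of
  Mathematics Studies 123 (1990), §2.2–§2.3 (pp. 13–14) [Rogawski1990].
* I. M. Gelfand, M. I. Graev, I. I. Piatetski-Shapiro, *Representation Theory and Automorphic
  Functions* (1969), Ch. 1 §2 [GelfandGraevPiatetskiShapiro1969].
* S. Gelbart, *Automorphic forms on adele groups*, Ann. of Math. Stud. 83 (1975), Remark 9.23 [Gelbart1975].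
* A. Deitmar, S. Echterhoff, *Principles of Harmonic Analysis*, 2nd ed. (2014), Prop. 9.1.5, Lemma 9.3.3
  [DeitmarEchterhoff2014].
* J. Arthur, *A trace formula for reductive groups I*, Duke Math. J. 45 (1978), §8 — cited through the
  held expositions above.
-/

set_option autoImplicit false

noncomputable section

open MeasureTheory NumberField IsDedekindDomain Topology Set
open Literature.MeasureTheory.Group
open scoped NNReal ENNReal MatrixGroups Pointwise

namespace Literature.NumberTheory.Automorphic

namespace UnitaryGroup

variable {F E : Type} [Field F] [NumberField F] [Field E] [NumberField E] [Algebra F E]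
  {c : E ≃ₐ[F] E}

omit [NumberField F] [Algebra F E] in
/-- `𝔸_E` is Hausdorff (local copy of the standard three-line argument). [folklore] -/
private theorem t2Space_adeleRing_E₁₀ : T2Space (AdeleRing (𝓞 E) E) := by
  haveI : T2Space (FiniteAdeleRing (𝓞 E) E) := inferInstanceAs <| T2Space
    (RestrictedProduct (fun w : HeightOneSpectrum (𝓞 E) => w.adicCompletion E)
      (fun w => (w.adicCompletionIntegers E : Set (w.adicCompletion E))) Filter.cofinite)
  haveI : T2Space (InfiniteAdeleRing E) :=
    inferInstanceAs <| T2Space ((w : InfinitePlace E) → w.Completion)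
  exact inferInstanceAs <| T2Space (InfiniteAdeleRing E × FiniteAdeleRing (𝓞 E) E)

/-- The centraliser of an element of a Hausdorff topological group is closed (the equaliser of
`g ↦ γ g` and `g ↦ g γ`; private copy of the lemma of ★ `UnitaryGroupTraceClasses`). [folklore] -/
private theorem isClosed_centralizer_singleton₁₀ {G : Type*} [Group G] [TopologicalSpace G]
    [ContinuousMul G] [T2Space G] (γ : G) :
    IsClosed ((Subgroup.centralizer ({γ} : Set G) : Subgroup G) : Set G) := by
  have h : ((Subgroup.centralizer ({γ} : Set G) : Subgroup G) : Set G) =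
      {g : G | γ * g = g * γ} := by
    ext g
    rw [SetLike.mem_coe, Subgroup.mem_centralizer_iff]
    simp only [Set.mem_singleton_iff, forall_eq, Set.mem_setOf_eq]
  rw [h]
  exact isClosed_eq (continuous_const.mul continuous_id) (continuous_id.mul continuous_const)

/-! ## §1 Bounded height on an elliptic centraliser; one compact set meets every `G(F)`-orbit on it -/

/-- **Bounded height on the centraliser of an elliptic element.** If no `G(F)`-conjugate of
`γ ∈ G(F)` lies in `B(F)`, there is `c₀ ≥ 1` with `H(δ z) ≤ c₀` for every `z ∈ Z_γ(𝔸_F)` and every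
`δ ∈ G(F)`: `(δz)⁻¹ (δγδ⁻¹) (δz) = z⁻¹ γ z = γ` lies in the compact `{γ}` while `δγδ⁻¹ ∉ B(F)`, and
Godement's bound ★ `exists_borelHeight_le_of_conj_mem_of_not_mem_arithmeticBorel` applies (Rogawski
(1990), §2.2: the elliptic classes contribute through a region of bounded height).
[cite: Rogawski1990, §2.2 (p. 13)] -/
theorem exists_forall_borelHeight_mul_le_of_forall_conj_not_mem_arithmeticBorel
    {γ : (quasiSplit F E c 3).arithmeticSubgroup}
    (hγ : ∀ δ : (quasiSplit F E c 3).arithmeticSubgroup, δ * γ * δ⁻¹ ∉ arithmeticBorel F E c 3) :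
    ∃ c₀ : ℝ≥0, 1 ≤ c₀ ∧ ∀ z : (quasiSplit F E c 3).Adelic,
      z ∈ Subgroup.centralizer ({(γ : (quasiSplit F E c 3).Adelic)} : Set (quasiSplit F E c 3).Adelic) →
        ∀ δ : (quasiSplit F E c 3).arithmeticSubgroup,
          borelHeight ((δ : (quasiSplit F E c 3).Adelic) * z) ≤ c₀ := by
  obtain ⟨c₀, hc₀⟩ := exists_borelHeight_le_of_conj_mem_of_not_mem_arithmeticBorel (F := F) (E := E) (c := c)
    (isCompact_singleton (x := ((γ : (quasiSplit F E c 3).Adelic))))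
  refine ⟨max 1 c₀, le_max_left _ _, fun z hz δ =>
    (hc₀ _ (δ * γ * δ⁻¹) (hγ δ) ?_).trans (le_max_right _ _)⟩
  -- `(δ z)⁻¹ (δ γ δ⁻¹) (δ z) = z⁻¹ γ z = γ`
  have hzγ : (γ : (quasiSplit F E c 3).Adelic) * z = z * γ :=
    (Subgroup.mem_centralizer_iff.1 hz) _ (Set.mem_singleton _)
  rw [Set.mem_singleton_iff, Subgroup.coe_mul, Subgroup.coe_mul, Subgroup.coe_inv]
  calc (((δ : (quasiSplit F E c 3).Adelic) * z))⁻¹ *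
        ((δ : (quasiSplit F E c 3).Adelic) * γ * (δ : (quasiSplit F E c 3).Adelic)⁻¹) *
          ((δ : (quasiSplit F E c 3).Adelic) * z)
      = z⁻¹ * ((γ : (quasiSplit F E c 3).Adelic) * z) := by group
    _ = z⁻¹ * (z * γ) := by rw [hzγ]
    _ = γ := by rw [inv_mul_cancel_left]

/-- **One compact set meets every `G(F)`-orbit on an elliptic centraliser**: under the hypothesis of
`exists_forall_borelHeight_mul_le_of_forall_conj_not_mem_arithmeticBorel` there is a compact
`Kc ⊆ G(𝔸_F)` such that every `z ∈ Z_γ(𝔸_F)` has a rational translate `δ z ∈ Kc`, `δ ∈ G(F)` — bounded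
height of all rational translates forces `h(ξ z) ≥ c₀⁻¹` for every rational vector `ξ ≠ 0` (★ H8a
`forall_inv_le_vecHeight_of_forall_borelHeight_le`), and Mahler's criterion
(★ `exists_isCompact_forall_exists_toAdelic_mul_mem`) gives the compact set.
[cite: Rogawski1990, §2.2 (p. 13)] -/
theorem exists_isCompact_forall_exists_mul_mem_centralizer (hc : c * c = 1)
    {γ : (quasiSplit F E c 3).arithmeticSubgroup}
    (hγ : ∀ δ : (quasiSplit F E c 3).arithmeticSubgroup, δ * γ * δ⁻¹ ∉ arithmeticBorel F E c 3) :
    ∃ Kc : Set (quasiSplit F E c 3).Adelic, IsCompact Kc ∧ ∀ z : (quasiSplit F E c 3).Adelic,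
      z ∈ Subgroup.centralizer ({(γ : (quasiSplit F E c 3).Adelic)} : Set (quasiSplit F E c 3).Adelic) →
        ∃ δ : (quasiSplit F E c 3).arithmeticSubgroup, (δ : (quasiSplit F E c 3).Adelic) * z ∈ Kc := by
  obtain ⟨c₀, h1, hH⟩ := exists_forall_borelHeight_mul_le_of_forall_conj_not_mem_arithmeticBorel hγ
  have hε : 0 < c₀⁻¹ := inv_pos.2 (lt_of_lt_of_le zero_lt_one h1)
  obtain ⟨Kc, hKc, hMah⟩ :=
    exists_isCompact_forall_exists_toAdelic_mul_mem (F := F) (E := E) (c := c) (N := 3) hε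
  refine ⟨Kc, hKc, fun z hz => ?_⟩
  obtain ⟨γr, hγr⟩ := hMah z (forall_inv_le_vecHeight_of_forall_borelHeight_le hc h1 (hH z hz))
  exact ⟨⟨(quasiSplit F E c 3).toAdelic γr, MonoidHom.mem_range.2 ⟨γr, rfl⟩⟩, hγr⟩

/-! ## §2 Set form: `Z_γ(𝔸_F) ⊆ K · Z_γ(F)` with `K ⊆ Z_γ(𝔸_F)` compact -/

/-- **Elliptic centralisers are cocompact modulo their rational points — set form.** If no
`G(F)`-conjugate of `γ ∈ G(F)` lies in `B(F)` (`G = U(J₃)`), there is a compact `K ⊆ Z_γ(𝔸_F)` with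
`Z_γ(𝔸_F) ⊆ K · (G(F) ∩ Z_γ(𝔸_F))`. Proof: §1 gives a compact `Kc` with `Z_γ(𝔸_F) ⊆ G(F) · Kc`; for
`z ∈ Z_γ(𝔸_F)` write `δ z⁻¹ = k ∈ Kc`; then `δ γ δ⁻¹ = k γ k⁻¹ ∈ G(F) ∩ Kc γ Kc⁻¹`, a FINITE set
(discrete meets compact, ★ `finite_setOf_mem_arithmeticSubgroup_of_isCompact`); with one `p_t ∈ G(F)`
chosen per value `t`, `m = p_t⁻¹ δ ∈ G(F)` centralises `γ` and `z = (k⁻¹ p_t) · m` with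
`k⁻¹ p_t = z m⁻¹ ∈ (Kc⁻¹ p_t) ∩ Z_γ(𝔸_F)` — the classical lattice lemma (Gelfand–Graev–Piatetski-Shapiro
(1969), Ch. 1 §2; ★ `exists_isCompact_centralizer_subset_mul`) with reduction theory supplying the
compact set. [cite: GelfandGraevPiatetskiShapiro1969, Ch. 1 §2] [cite: Rogawski1990, §2.2 (p. 13)] -/
theorem exists_isCompact_centralizer_subset_mul_of_forall_conj_not_mem_arithmeticBorel (hc : c * c = 1)
    {γ : (quasiSplit F E c 3).arithmeticSubgroup}
    (hγ : ∀ δ : (quasiSplit F E c 3).arithmeticSubgroup, δ * γ * δ⁻¹ ∉ arithmeticBorel F E c 3) :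
    ∃ K : Set (quasiSplit F E c 3).Adelic, IsCompact K ∧
      K ⊆ Subgroup.centralizer ({(γ : (quasiSplit F E c 3).Adelic)} : Set (quasiSplit F E c 3).Adelic) ∧
      ((Subgroup.centralizer ({(γ : (quasiSplit F E c 3).Adelic)} : Set (quasiSplit F E c 3).Adelic) :
          Subgroup (quasiSplit F E c 3).Adelic) : Set (quasiSplit F E c 3).Adelic) ⊆
        K * (((quasiSplit F E c 3).arithmeticSubgroup ⊓
          Subgroup.centralizer ({(γ : (quasiSplit F E c 3).Adelic)} : Set (quasiSplit F E c 3).Adelic) :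
            Subgroup (quasiSplit F E c 3).Adelic) : Set (quasiSplit F E c 3).Adelic) := by
  classical
  haveI := t2Space_adeleRing_E₁₀ (E := E)
  haveI : T2Space (quasiSplit F E c 3).Adelic :=
    inferInstanceAs (T2Space (adelic F E c 3 ((StdForm.antidiagonal 3).over E)))
  obtain ⟨Kc, hKc, hdec⟩ := exists_isCompact_forall_exists_mul_mem_centralizer hc hγ
  set Z : Subgroup (quasiSplit F E c 3).Adelic :=
    Subgroup.centralizer ({(γ : (quasiSplit F E c 3).Adelic)} : Set (quasiSplit F E c 3).Adelic) with hZ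
  have hZc : IsClosed (Z : Set (quasiSplit F E c 3).Adelic) :=
    isClosed_centralizer_singleton₁₀ (γ : (quasiSplit F E c 3).Adelic)
  have hmemZ : ∀ g : (quasiSplit F E c 3).Adelic, g ∈ Z ↔ (γ : (quasiSplit F E c 3).Adelic) * g = g * γ :=
    fun g => by
      rw [hZ, Subgroup.mem_centralizer_iff]
      simp only [Set.mem_singleton_iff, forall_eq]
  -- the compact set `S = Kc γ Kc⁻¹` meets the discrete `G(F)` in a finite set
  set S : Set (quasiSplit F E c 3).Adelic :=
    (fun p : (quasiSplit F E c 3).Adelic × (quasiSplit F E c 3).Adelic =>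
      p.1 * (γ : (quasiSplit F E c 3).Adelic) * p.2⁻¹) '' (Kc ×ˢ Kc) with hS
  have hSc : IsCompact S :=
    (hKc.prod hKc).image ((continuous_fst.mul continuous_const).mul continuous_snd.inv)
  have hfin : {t : (quasiSplit F E c 3).arithmeticSubgroup |
      (1 : (quasiSplit F E c 3).Adelic)⁻¹ * (t : (quasiSplit F E c 3).Adelic) * 1 ∈ S}.Finite :=
    finite_setOf_mem_arithmeticSubgroup_of_isCompact hSc 1 1
  -- one `p_t ∈ G(F)` for every `G(F)`-conjugate `t` of `γ`
  have hpick : ∀ t : (quasiSplit F E c 3).arithmeticSubgroup, ∃ p : (quasiSplit F E c 3).arithmeticSubgroup,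
      (∃ δ' : (quasiSplit F E c 3).arithmeticSubgroup, δ' * γ * δ'⁻¹ = t) → p * γ * p⁻¹ = t := by
    intro t
    by_cases h : ∃ δ' : (quasiSplit F E c 3).arithmeticSubgroup, δ' * γ * δ'⁻¹ = t
    · obtain ⟨δ', h'⟩ := h
      exact ⟨δ', fun _ => h'⟩
    · exact ⟨1, fun h' => absurd h' h⟩
  choose pick hpick using hpick
  set K₀ : Set (quasiSplit F E c 3).Adelic := ⋃ t ∈ hfin.toFinset,
    (fun k : (quasiSplit F E c 3).Adelic => k⁻¹ * ((pick t : (quasiSplit F E c 3).arithmeticSubgroup) :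
      (quasiSplit F E c 3).Adelic)) '' Kc with hK₀
  have hK₀c : IsCompact K₀ :=
    hfin.toFinset.isCompact_biUnion fun t _ => hKc.image ((continuous_inv).mul continuous_const)
  refine ⟨K₀ ∩ (Z : Set (quasiSplit F E c 3).Adelic), hK₀c.inter_right hZc, Set.inter_subset_right,
    fun z hz => ?_⟩
  have hzZ : z ∈ Z := hz
  -- `δ z⁻¹ = k ∈ Kc`
  obtain ⟨δ, hk⟩ := hdec z⁻¹ (Z.inv_mem hzZ)
  set k : (quasiSplit F E c 3).Adelic := (δ : (quasiSplit F E c 3).Adelic) * z⁻¹ with hk_def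
  have hzγ : (γ : (quasiSplit F E c 3).Adelic) * z = z * γ := (hmemZ z).1 hzZ
  -- the conjugate `t = δ γ δ⁻¹ = k γ k⁻¹ ∈ S ∩ G(F)`
  set t : (quasiSplit F E c 3).arithmeticSubgroup := δ * γ * δ⁻¹ with ht_def
  have htk : (t : (quasiSplit F E c 3).Adelic) = k * γ * k⁻¹ := by
    rw [ht_def, Subgroup.coe_mul, Subgroup.coe_mul, Subgroup.coe_inv, hk_def]
    calc (δ : (quasiSplit F E c 3).Adelic) * γ * (δ : (quasiSplit F E c 3).Adelic)⁻¹
        = (δ : (quasiSplit F E c 3).Adelic) * (z⁻¹ * (z * γ)) * z⁻¹ * (z * (δ : (quasiSplit F E c 3).Adelic)⁻¹) := by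
          group
      _ = (δ : (quasiSplit F E c 3).Adelic) * (z⁻¹ * ((γ : (quasiSplit F E c 3).Adelic) * z)) * z⁻¹ *
            (z * (δ : (quasiSplit F E c 3).Adelic)⁻¹) := by rw [hzγ]
      _ = (δ : (quasiSplit F E c 3).Adelic) * z⁻¹ * γ * ((δ : (quasiSplit F E c 3).Adelic) * z⁻¹)⁻¹ := by
          group
  have htS : (t : (quasiSplit F E c 3).Adelic) ∈ S := ⟨(k, k), ⟨hk, hk⟩, htk.symm⟩
  have htT : t ∈ hfin.toFinset := by
    rw [Set.Finite.mem_toFinset, Set.mem_setOf_eq, inv_one, one_mul, mul_one]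
    exact htS
  -- the chosen representative `p = p_t` and `m = p⁻¹ δ ∈ Z_γ(F)`
  set p : (quasiSplit F E c 3).arithmeticSubgroup := pick t with hp_def
  have hpt : p * γ * p⁻¹ = t := hpick t ⟨δ, rfl⟩
  set m : (quasiSplit F E c 3).arithmeticSubgroup := p⁻¹ * δ with hm_def
  have hmγ : m * γ * m⁻¹ = γ := by
    calc m * γ * m⁻¹ = p⁻¹ * (δ * γ * δ⁻¹) * p := by rw [hm_def]; group
      _ = p⁻¹ * (p * γ * p⁻¹) * p := by rw [← ht_def, ← hpt]
      _ = γ := by group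
  have hmZ : ((m : (quasiSplit F E c 3).arithmeticSubgroup) : (quasiSplit F E c 3).Adelic) ∈ Z := by
    rw [hmemZ]
    have h := congrArg (fun x : (quasiSplit F E c 3).arithmeticSubgroup => (x : (quasiSplit F E c 3).Adelic) * m) hmγ
    simp only [Subgroup.coe_mul, Subgroup.coe_inv, inv_mul_cancel_right] at h
    exact h.symm
  -- `z = (k⁻¹ p) · m`
  have hem : k⁻¹ * (p : (quasiSplit F E c 3).Adelic) * m = z := by
    rw [hk_def, hm_def, Subgroup.coe_mul, Subgroup.coe_inv]
    group
  have heZ : k⁻¹ * (p : (quasiSplit F E c 3).Adelic) ∈ Z := by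
    have h : k⁻¹ * (p : (quasiSplit F E c 3).Adelic) = z * ((m : (quasiSplit F E c 3).Adelic))⁻¹ := by
      rw [← hem]; group
    rw [h]
    exact Z.mul_mem hzZ (Z.inv_mem hmZ)
  have heK : k⁻¹ * (p : (quasiSplit F E c 3).Adelic) ∈ K₀ := Set.mem_iUnion₂.2 ⟨t, htT, k, hk, rfl⟩
  exact Set.mem_mul.2 ⟨k⁻¹ * (p : (quasiSplit F E c 3).Adelic), ⟨heK, heZ⟩, m,
    Subgroup.mem_inf.2 ⟨m.2, hmZ⟩, hem⟩

/-! ## §3 `Z_γ(𝔸_F) ⧸ (A_G G(F) ∩ Z_γ(𝔸_F))` is compact for elliptic `γ` -/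

/-- **ELLIPTIC CENTRALISERS ARE COCOMPACT** (`G = U(J₃)` quasi-split, reduction theory, no torus
classification): if no `G(F)`-conjugate of `γ ∈ G(F)` lies in the rational Borel `B(F)`, then
`Z_γ(𝔸_F) ⧸ (A_G · G(F) ∩ Z_γ(𝔸_F))` is compact (`A_G = 1` for the unitary group, ★ `quotientSubgroup_quasiSplit`)
— stated in the letters of ★ `AdelicGroupData.compactSpace_centralizer_quotient`, the per-class
compactness input of the tree's geometric side (★ `exists_lintegral_conjTsum_eq_tsum` and its subset
form), here for the ELLIPTIC classes of the non-compact quotient `G(F)\G(𝔸_F)` (Rogawski (1990), §2.2–§2.3: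
the elliptic `𝔬` give `Σ vol(G_γ(F)\G_γ(𝔸)) · Φ(γ, f)` with finite volumes; Gelbart (1975), Remark 9.23).
[cite: Rogawski1990, §2.2 (p. 13)] [cite: GelfandGraevPiatetskiShapiro1969, Ch. 1 §2] -/
theorem compactSpace_centralizer_quotient_of_forall_conj_not_mem_arithmeticBorel (hc : c * c = 1)
    {γ : (quasiSplit F E c 3).arithmeticSubgroup}
    (hγ : ∀ δ : (quasiSplit F E c 3).arithmeticSubgroup, δ * γ * δ⁻¹ ∉ arithmeticBorel F E c 3) :
    CompactSpace (↥(Subgroup.centralizer ({(γ : (quasiSplit F E c 3).Adelic)} : Set (quasiSplit F E c 3).Adelic)) ⧸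
      ((quasiSplit F E c 3).quotientSubgroup ⊓
        Subgroup.centralizer ({(γ : (quasiSplit F E c 3).Adelic)} : Set (quasiSplit F E c 3).Adelic)).subgroupOf
          (Subgroup.centralizer ({(γ : (quasiSplit F E c 3).Adelic)} : Set (quasiSplit F E c 3).Adelic))) := by
  haveI := t2Space_adeleRing_E₁₀ (E := E)
  haveI : T2Space (quasiSplit F E c 3).Adelic :=
    inferInstanceAs (T2Space (adelic F E c 3 ((StdForm.antidiagonal 3).over E)))
  obtain ⟨K, hK, hKZ, hZK⟩ := exists_isCompact_centralizer_subset_mul_of_forall_conj_not_mem_arithmeticBorel hc hγ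
  rw [quotientSubgroup_quasiSplit (F := F) (E := E) (c := c) (N := 3)]
  exact compactSpace_quotient_subgroupOf_of_subset_mul
    ((quasiSplit F E c 3).arithmeticSubgroup ⊓
      Subgroup.centralizer ({(γ : (quasiSplit F E c 3).Adelic)} : Set (quasiSplit F E c 3).Adelic))
    (Subgroup.centralizer ({(γ : (quasiSplit F E c 3).Adelic)} : Set (quasiSplit F E c 3).Adelic))
    (isClosed_centralizer_singleton₁₀ (γ : (quasiSplit F E c 3).Adelic)) hK hKZ hZK

/-- **A class that misses `B(F)` consists of elliptic elements**: for a conjugation-invariant class map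
`cl` (★ `IsConjInvariant`) and a class `i` with `cl β ≠ i` for every `β ∈ B(F)` (the hypothesis of
★ `truncatedKernelClass_eq_kernelClass_of_forall_ne`), no conjugate of an element of class `i` lies in
`B(F)`. [cite: Rogawski1990, §2.2 (p. 13)] -/
theorem forall_conj_not_mem_arithmeticBorel_of_forall_cl_ne {N : ℕ} {ι : Type*}
    {cl : (quasiSplit F E c N).arithmeticSubgroup → ι} (hcl : IsConjInvariant cl) {i : ι}
    (hi : ∀ β : arithmeticBorel F E c N, cl β ≠ i) {γ : (quasiSplit F E c N).arithmeticSubgroup}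
    (hγi : cl γ = i) :
    ∀ δ : (quasiSplit F E c N).arithmeticSubgroup, δ * γ * δ⁻¹ ∉ arithmeticBorel F E c N := by
  intro δ hδ
  exact hi ⟨δ * γ * δ⁻¹, hδ⟩ ((hcl γ δ).trans hγi)

/-- **ELLIPTIC CENTRALISERS ARE COCOMPACT — class-map form**: for a conjugation-invariant class map `cl`
on `G(F)` (`G = U(J₃)`), a class `i` missing `B(F)` and any `γ` of class `i`,
`Z_γ(𝔸_F) ⧸ (A_G · G(F) ∩ Z_γ(𝔸_F))` is compact (the per-class `CompactSpace` binder of the elliptic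
unfolding, at `γ := rep s`). [cite: Rogawski1990, §2.2 (p. 13)] -/
theorem compactSpace_centralizer_quotient_of_forall_cl_ne (hc : c * c = 1) {ι : Type*}
    {cl : (quasiSplit F E c 3).arithmeticSubgroup → ι} (hcl : IsConjInvariant cl) {i : ι}
    (hi : ∀ β : arithmeticBorel F E c 3, cl β ≠ i) {γ : (quasiSplit F E c 3).arithmeticSubgroup}
    (hγi : cl γ = i) :
    CompactSpace (↥(Subgroup.centralizer ({(γ : (quasiSplit F E c 3).Adelic)} : Set (quasiSplit F E c 3).Adelic)) ⧸
      ((quasiSplit F E c 3).quotientSubgroup ⊓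
        Subgroup.centralizer ({(γ : (quasiSplit F E c 3).Adelic)} : Set (quasiSplit F E c 3).Adelic)).subgroupOf
          (Subgroup.centralizer ({(γ : (quasiSplit F E c 3).Adelic)} : Set (quasiSplit F E c 3).Adelic))) :=
  compactSpace_centralizer_quotient_of_forall_conj_not_mem_arithmeticBorel hc
    (forall_conj_not_mem_arithmeticBorel_of_forall_cl_ne hcl hi hγi)

/-! ## §4 (ED. 2) Elliptic centralisers are unimodular -/

section Unimodular

variable [MeasurableSpace (quasiSplit F E c 3).Adelic] [BorelSpace (quasiSplit F E c 3).Adelic]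

/-- **ELLIPTIC CENTRALISERS ARE UNIMODULAR** (`G = U(J₃)` quasi-split): if no `G(F)`-conjugate of
`γ ∈ G(F)` lies in `B(F)`, every Haar measure of `Z_γ(𝔸_F) = C_{G(𝔸_F)}(γ)` is right invariant —
`Z_γ(F) = G(F) ∩ Z_γ(𝔸_F)` is a discrete (★ `isDiscreteRational_quasiSplit`) cocompact (§3) subgroup, and
a locally compact second countable group with a discrete cocompact subgroup is unimodular
(★ `LevelOrbit.isMulRightInvariant_of_compactSpace_quotient`; Deitmar–Echterhoff (2014), Lemma 9.3.3:
«the centralizer `G_γ` is unimodular», there for a uniform lattice — the proof of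
★ `isMulRightInvariant_centralizer_of_center'_eq_bot` with its compact-quotient input replaced by §3).
This is the two-sidedness of the Haar measure `νC` of `Z_γ(𝔸_F)` under which the Weil quotient measure
`dν/dνC` on `G(𝔸_F) ⧸ Z_γ(𝔸_F)` carrying the orbital integral at `γ` exists.
[cite: DeitmarEchterhoff2014, Lemma 9.3.3] [cite: Rogawski1990, §2.2 (p. 13)] -/
theorem isMulRightInvariant_centralizer_of_forall_conj_not_mem_arithmeticBorel (hc : c * c = 1)
    {γ : (quasiSplit F E c 3).arithmeticSubgroup}
    (hγ : ∀ δ : (quasiSplit F E c 3).arithmeticSubgroup, δ * γ * δ⁻¹ ∉ arithmeticBorel F E c 3)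
    (νZ : Measure ↥(Subgroup.centralizer ({(γ : (quasiSplit F E c 3).Adelic)} : Set (quasiSplit F E c 3).Adelic))) [νZ.IsHaarMeasure] : νZ.IsMulRightInvariant := by
  -- topology of `G = U(J₃)(𝔸_F)`
  haveI := secondCountableTopology_adeleRing E
  haveI := locallyCompactSpace_adeleRing' E
  haveI := t2Space_adeleRing_E₁₀ (E := E)
  haveI : T2Space (quasiSplit F E c 3).Adelic :=
    inferInstanceAs (T2Space (adelic F E c 3 ((StdForm.antidiagonal 3).over E)))
  haveI : LocallyCompactSpace (quasiSplit F E c 3).Adelic :=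
    inferInstanceAs (LocallyCompactSpace (adelic F E c 3 ((StdForm.antidiagonal 3).over E)))
  haveI : SecondCountableTopology (quasiSplit F E c 3).Adelic :=
    inferInstanceAs (SecondCountableTopology (adelic F E c 3 ((StdForm.antidiagonal 3).over E)))
  have hZc : IsClosed ((Subgroup.centralizer ({(γ : (quasiSplit F E c 3).Adelic)} : Set (quasiSplit F E c 3).Adelic)) : Set (quasiSplit F E c 3).Adelic) :=
    isClosed_centralizer_singleton₁₀ (γ : (quasiSplit F E c 3).Adelic)
  haveI : LocallyCompactSpace ↥(Subgroup.centralizer ({(γ : (quasiSplit F E c 3).Adelic)} : Set (quasiSplit F E c 3).Adelic)) := hZc.isClosedEmbedding_subtypeVal.locallyCompactSpace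
  haveI : SecondCountableTopology ↥(Subgroup.centralizer ({(γ : (quasiSplit F E c 3).Adelic)} : Set (quasiSplit F E c 3).Adelic)) := TopologicalSpace.Subtype.secondCountableTopology _
  -- the subgroup `Z_γ(F) = A_G G(F) ∩ Z_γ(𝔸_F)` of `Z_γ(𝔸_F)` is discrete
  haveI : DiscreteTopology ↥(quasiSplit F E c 3).arithmeticSubgroup := isDiscreteRational_quasiSplit
  have hmemΛ : ∀ x : ↥(Subgroup.centralizer ({(γ : (quasiSplit F E c 3).Adelic)} : Set (quasiSplit F E c 3).Adelic)), x ∈ ((quasiSplit F E c 3).quotientSubgroup ⊓ (Subgroup.centralizer ({(γ : (quasiSplit F E c 3).Adelic)} : Set (quasiSplit F E c 3).Adelic))).subgroupOf (Subgroup.centralizer ({(γ : (quasiSplit F E c 3).Adelic)} : Set (quasiSplit F E c 3).Adelic)) →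
      (x : (quasiSplit F E c 3).Adelic) ∈ (quasiSplit F E c 3).arithmeticSubgroup := fun x hx => by
    have h := (Subgroup.mem_inf.1 (Subgroup.mem_subgroupOf.1 hx)).1
    rwa [quotientSubgroup_quasiSplit] at h
  haveI : DiscreteTopology ↥(((quasiSplit F E c 3).quotientSubgroup ⊓ (Subgroup.centralizer ({(γ : (quasiSplit F E c 3).Adelic)} : Set (quasiSplit F E c 3).Adelic))).subgroupOf (Subgroup.centralizer ({(γ : (quasiSplit F E c 3).Adelic)} : Set (quasiSplit F E c 3).Adelic))) := by
    refine DiscreteTopology.of_continuous_injective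
      (f := fun x => (⟨((x : ↥(Subgroup.centralizer ({(γ : (quasiSplit F E c 3).Adelic)} : Set (quasiSplit F E c 3).Adelic))) : (quasiSplit F E c 3).Adelic), hmemΛ x x.2⟩ :
        ↥(quasiSplit F E c 3).arithmeticSubgroup)) ?_ ?_
    · exact (continuous_subtype_val.comp continuous_subtype_val).subtype_mk _
    · intro a b hab
      have h : (((a : ↥(Subgroup.centralizer ({(γ : (quasiSplit F E c 3).Adelic)} : Set (quasiSplit F E c 3).Adelic)))) : (quasiSplit F E c 3).Adelic) = (((b : ↥(Subgroup.centralizer ({(γ : (quasiSplit F E c 3).Adelic)} : Set (quasiSplit F E c 3).Adelic)))) : (quasiSplit F E c 3).Adelic) :=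
        congrArg (fun y : ↥(quasiSplit F E c 3).arithmeticSubgroup => (y : (quasiSplit F E c 3).Adelic)) hab
      exact Subtype.ext (Subtype.ext h)
  -- and cocompact (§3)
  haveI := compactSpace_centralizer_quotient_of_forall_conj_not_mem_arithmeticBorel hc hγ
  exact LevelOrbit.isMulRightInvariant_of_compactSpace_quotient
    (((quasiSplit F E c 3).quotientSubgroup ⊓ (Subgroup.centralizer ({(γ : (quasiSplit F E c 3).Adelic)} : Set (quasiSplit F E c 3).Adelic))).subgroupOf (Subgroup.centralizer ({(γ : (quasiSplit F E c 3).Adelic)} : Set (quasiSplit F E c 3).Adelic))) νZ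

/-- **ELLIPTIC CENTRALISERS ARE UNIMODULAR — class-map form**: for a conjugation-invariant class map
`cl`, a class `i` missing `B(F)` and `γ` of class `i`, every Haar measure of `Z_γ(𝔸_F)` is right invariant
(the two-sidedness of `νC s` at `γ := rep s` in the orbital unfolding of `J^T_𝔬`).
[cite: DeitmarEchterhoff2014, Lemma 9.3.3] [cite: Rogawski1990, §2.2 (p. 13)] -/
theorem isMulRightInvariant_centralizer_of_forall_cl_ne (hc : c * c = 1) {ι : Type*}
    {cl : (quasiSplit F E c 3).arithmeticSubgroup → ι} (hcl : IsConjInvariant cl) {i : ι}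
    (hi : ∀ β : arithmeticBorel F E c 3, cl β ≠ i) {γ : (quasiSplit F E c 3).arithmeticSubgroup}
    (hγi : cl γ = i) (νZ : Measure ↥(Subgroup.centralizer ({(γ : (quasiSplit F E c 3).Adelic)} : Set (quasiSplit F E c 3).Adelic))) [νZ.IsHaarMeasure] : νZ.IsMulRightInvariant :=
  isMulRightInvariant_centralizer_of_forall_conj_not_mem_arithmeticBorel hc
    (forall_conj_not_mem_arithmeticBorel_of_forall_cl_ne hcl hi hγi) νZ

end Unimodular

end UnitaryGroup

end Literature.NumberTheory.Automorphic
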